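import Summits.QuantumFields.GaugeBoot.TiltedBoxTwoDimAnnulus
import Literature.MathematicalPhysics.QuantumFieldTheory.LatticeSiteRPMechanism
import HarnessLib

/-!
# The hybrid axis mirror of the odd square tilted box IS reflection positive in two dimensions (gauge-boot, L3 supplement: 2D slab gluing 6/6)

HONEST FRAMING (cell `pub-gaugeboot`, page 1 of every file): the venture produces certified bounds
on lattice expectations at stated coupling, gauge group, dimension and torus size; NOT a mass gap,
NOT a continuum limit, NOT a string tension; NOT Yang–Mills-summit-bearing (barriers
`FixedCouplingUltralocality`, `PerturbativeInvisibility`). A structural POSITIVE result about a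
reflection of a two-dimensional periodic box; it bounds no expectation of the venture's tables.

`TiltedBoxOddAxisRPNegative.lean` proved: on the square tilted box `ℤ^d/Γ(2P+1, 2P+1, L)` in `d ≥ 3`
the in-plane axis flip `Θ_i : x_i ↦ -x_i` — a "hybrid frame": the layer `x_i ≡ 0` is fixed
pointwise, the slab between the layers `P` and `P + 1` is mapped to itself WITH THE TWIST
`Θ_i y = y + e_i + T`, `T = [M e_j]` — is NOT of positive type for the closed half `{0 ≤ x_i ≤ P}` at
any `β > 0`, and announced that in `d = 2` the argument does not apply. This module proves the
positive statement:

* **`tiltedBox_axisRP_odd_twoDim`** — in two dimensions (`∀ k, k = i ∨ k = j`), for every compact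
  second countable `G`, every continuous `ρ`, EVERY real `β`, every `P ≥ 1` (and any `L`):
  `0 ≤ ∫ conj F(Θ_i U) · F(U) dμ_β` for every bounded measurable observable `F` of the closed half
  `{0 ≤ x_i ≤ P}` (read through `axisHeight2`, exactly the shape refuted in `d ≥ 3` by
  `not_tiltedBox_axisRP_odd`).

**Proof (two-dimensional Yang–Mills gluing, elementary form).** The Boltzmann weight splits as
`e^{-βS} = e^{-βE(U)} e^{-βE(ΘU)} e^{-β ∑_{slab}(N - Re tr)}` (`oddExpo_configReflect_add`). In two
dimensions the slab is an annulus of `2M` plaquettes around the layer cycle (`TiltedBoxTwoDimBlocks`);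
integrating its `2M` rungs (`SlabKernel.integral_mul_annulus`) leaves the slab kernel
`k_ψ(a(U), b(U))`, `ψ = ω_β^{⋆M}`, of the ordered products `a`, `b` of the `j`-links of the layers `P`
and `P + 1`; the twist makes `b(U)` a conjugate of `a(Θ U)` (`oprod_bFn_eq_conj`) and `k_ψ` is a class
function in each slot, so `k_ψ(a(U), b(U)) = k_ψ(a(U), a(ΘU))`. Finally
`k_ψ(α, β') = ∫ e_ψ(α, u) e_ψ(β', u) du` with a REAL feature map (`SlabKernelGram`: the number of
plaquettes around the annulus is even), so pointwise in `u` the tree's shared-block mechanism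
`LatticeRP.integral_splice_mul_conj_comp_of_shared_nonneg` (shared block = the `j`-links of the fixed
layer, positive block = the other half links, no crossing links) applies to
`Ψ_u = F e^{-βE} e_ψ(a(·), u)`, and Fubini over `u` concludes. No character expansion and no sign
condition on `β` enter. In `d ≥ 3` the slab is not an annulus and the rung integral is not a function
of two holonomies — which is where `TiltedBoxOddAxisRPNegative.lean` finds its witness.

Classification of the in-plane axis mirrors `x_i ↦ c - x_i` of the square tilted boxes (with
`TiltedBoxAxisRPNegative`, `TiltedBoxOddAxisRPNegative`, `TiltedBoxEvenMidAxisRPNegative`,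
`TiltedBoxOddMidAxisRPNegative`): the two classes with a twisted LAYER fail in every `d ≥ 2` at every
`β`; the two classes with a twisted SLAB fail in `d ≥ 3` for `β > 0` and — this file, the odd side —
HOLD in `d = 2` for every `β`. Small new positive result; mechanism folklore (Migdal's 1975
recursion, Osterwalder–Seiler factorisation).

References: A. A. Migdal, Sov. Phys. JETP 42 (1975) 413; K. Osterwalder, E. Seiler, Ann. Phys. 110
(1978) 440, §2; J. Fröhlich, R. Israel, E. H. Lieb, B. Simon, J. Stat. Phys. 22 (1980) 297, §3;
M. Biskup, in LNM 1970 (2009) §5.4–5.5.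
-/

noncomputable section

open MeasureTheory Complex Function
open scoped ComplexOrder ComplexConjugate
open Literature.MathematicalPhysics.QuantumFieldTheory (haarProbability)
open Literature.MathematicalPhysics.QuantumFieldTheory.LatticeRP (piMeasure splice splice_eq_piecewise
  integral_splice_mul_conj_comp_of_shared_nonneg)
open Literature.RepresentationTheory.CompactGroups

namespace Summit.QuantumFields.GaugeBoot

namespace TiltedRP

namespace TwoDim

variable {d : ℕ} {i j : Fin d} {L P N : ℕ} [NeZero L] [NeZero P]
variable {G : Type*} [Group G] [TopologicalSpace G] [IsTopologicalGroup G] [CompactSpace G]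
  [MeasurableSpace G] [BorelSpace G] [SecondCountableTopology G]
variable (ρ : G →* Matrix (Fin N) (Fin N) ℂ)

/-! ## Integrals of pointwise non-negative complex functions -/

omit [NeZero L] [NeZero P] in
/-- A Bochner integral of a pointwise non-negative complex function is non-negative. [folklore] -/
theorem integral_nonneg_of_complex {X : Type*} [MeasurableSpace X] {ν : Measure X} {f : X → ℂ}
    (hf : ∀ x, 0 ≤ f x) : 0 ≤ ∫ x, f x ∂ν := by
  have h1 : ∀ x, f x = ((f x).re : ℂ) := fun x => by
    obtain ⟨-, him⟩ := Complex.nonneg_iff.1 (hf x)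
    exact Complex.ext (by simp) (by simp [← him])
  rw [show (fun x => f x) = fun x => ((f x).re : ℂ) from funext h1, integral_complex_ofReal]
  exact Complex.zero_le_real.2 (integral_nonneg fun x => (Complex.nonneg_iff.1 (hf x)).1)

/-! ## The half observable `g = F e^{-βE}` and the rungs -/

/-- The half-weighted observable `g = F · e^{-β E}` (`E = oddExpo`). -/
def gTwo (β : ℝ) (F : Config (TiltedSite d i j (2 * P + 1) (2 * P + 1) L) d G → ℂ)
    (U : Config (TiltedSite d i j (2 * P + 1) (2 * P + 1) L) d G) : ℂ :=
  F U * (Real.exp (-β * oddExpo ρ U) : ℂ)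

omit [NeZero P] [TopologicalSpace G] [IsTopologicalGroup G] [CompactSpace G] [MeasurableSpace G] [BorelSpace G]
  [SecondCountableTopology G] in
/-- `E = oddExpo` depends only on the links of the closed half. [folklore] -/
theorem oddExpo_eq_of_halfLinks {U V : Config (TiltedSite d i j (2 * P + 1) (2 * P + 1) L) d G}
    (hUV : ∀ l, IsHalfLink (tiltedUnit d i j (2 * P + 1) (2 * P + 1) L) (2 * P + 1)
      (axisHeight2 d L (2 * P + 1)) l → U l = V l) : oddExpo ρ U = oddExpo ρ V := by
  unfold oddExpo
  refine Finset.sum_congr rfl fun p _ => ?_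
  by_cases hp : halfWeight p = 0
  · rw [hp, zero_mul, zero_mul]
  · rw [plaqObs_eq_of_halfWeight_ne_zero ρ hUV hp]

omit [NeZero P] [TopologicalSpace G] [IsTopologicalGroup G] [CompactSpace G] [MeasurableSpace G] [BorelSpace G]
  [SecondCountableTopology G] in
/-- `g` is an observable of the closed half. [folklore] -/
theorem gTwo_eq_of_halfLinks (β : ℝ) {F : Config (TiltedSite d i j (2 * P + 1) (2 * P + 1) L) d G → ℂ}
    (hFo : IsHalfObservable (tiltedUnit d i j (2 * P + 1) (2 * P + 1) L) (2 * P + 1) (axisHeight2 d L (2 * P + 1)) F)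
    {U V : Config (TiltedSite d i j (2 * P + 1) (2 * P + 1) L) d G}
    (hUV : ∀ l, IsHalfLink (tiltedUnit d i j (2 * P + 1) (2 * P + 1) L) (2 * P + 1)
      (axisHeight2 d L (2 * P + 1)) l → U l = V l) : gTwo ρ β F U = gTwo ρ β F V := by
  unfold gTwo
  rw [hFo U V hUV, oddExpo_eq_of_halfLinks ρ hUV]

section Rungs

variable [DecidableEq (TiltedSite d i j (2 * P + 1) (2 * P + 1) L)]

omit [NeZero L] [Group G] [TopologicalSpace G] [IsTopologicalGroup G] [CompactSpace G] [MeasurableSpace G]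
  [BorelSpace G] [SecondCountableTopology G] in
/-- Updating a rung does not change the half links. [folklore] -/
theorem halfLinks_update_rung (hij : i ≠ j) (U : Config (TiltedSite d i j (2 * P + 1) (2 * P + 1) L) d G)
    (s : ℕ) (z : G) (l : Link (TiltedSite d i j (2 * P + 1) (2 * P + 1) L) d)
    (hl : IsHalfLink (tiltedUnit d i j (2 * P + 1) (2 * P + 1) L) (2 * P + 1) (axisHeight2 d L (2 * P + 1)) l) :
    update U (rung s) z l = U l := by
  rw [update_of_ne]
  rintro rfl
  exact rung_not_isHalfLink hij s hl

omit [TopologicalSpace G] [IsTopologicalGroup G] [CompactSpace G] [MeasurableSpace G] [BorelSpace G]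
  [SecondCountableTopology G] in
/-- Updating a rung does not change the REFLECTED half links: the flip reads a half link `(x, k)` off
`siteLinkMap (x, k)`, which is never a rung (a `j`-link, or an `i`-link with `x_i ≤ P - 1`, whose image
has `x_i = -x_i(x) - 1 ≠ P`). [folklore] -/
theorem configReflect_update_rung (hij : i ≠ j) (hd : ∀ k : Fin d, k = i ∨ k = j)
    (U : Config (TiltedSite d i j (2 * P + 1) (2 * P + 1) L) d G) (s : ℕ) (z : G)
    (l : Link (TiltedSite d i j (2 * P + 1) (2 * P + 1) L) d)
    (hl : IsHalfLink (tiltedUnit d i j (2 * P + 1) (2 * P + 1) L) (2 * P + 1) (axisHeight2 d L (2 * P + 1)) l) :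
    configReflect (tiltedUnit d i j (2 * P + 1) (2 * P + 1) L) i (tiltedAxisFlip d L (2 * P + 1) hij)
        (update U (rung s) z) l =
      configReflect (tiltedUnit d i j (2 * P + 1) (2 * P + 1) L) i (tiltedAxisFlip d L (2 * P + 1) hij) U l := by
  have hP : 1 ≤ P := one_le_P
  have hne : siteLinkMap (tiltedUnit d i j (2 * P + 1) (2 * P + 1) L) i (tiltedAxisFlip d L (2 * P + 1) hij) l ≠
      rung s := by
    obtain ⟨x, k⟩ := l
    rcases hd k with hk | hk
    · rw [hk] at hl ⊢
      rw [siteLinkMap_self]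
      intro h
      have hx := (isHalfLink_iff_mem_blocks hij hd (x, i)).1 hl
      rw [mem_posBlock, mem_shBlock] at hx
      simp only [hij, false_and, false_or, true_and, or_false] at hx
      have h1 := congrArg (fun l => axisCoord d L (2 * P + 1) l.1) h
      simp only [rung, map_sub, axisCoord_tiltedAxisFlip, axisCoord_tiltedUnit_self, axisCoord_cyc hij,
        axisCoord_oddLayerSite] at h1
      have h2 : axisCoord d L (2 * P + 1) x = ((P : ℕ) : ZMod (2 * P + 1)) := by
        have h0 : ((2 * P + 1 : ℕ) : ZMod (2 * P + 1)) = 0 := ZMod.natCast_self _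
        push_cast at h0
        linear_combination (-1 : ZMod (2 * P + 1)) * h1 - h0
      rw [h2, ZMod.val_natCast, Nat.mod_eq_of_lt (by omega)] at hx
      omega
    · rw [hk, siteLinkMap_other _ i _ x (Ne.symm hij)]
      exact fun h => hij (congrArg Prod.snd h).symm
  unfold configReflect
  rw [update_of_ne hne]

end Rungs

/-! ## The Boltzmann weight: split and rung elimination -/

/-- The integrand after the split: `h = g · conj(g ∘ Θ_i)`. -/
def hTwo (β : ℝ) (F : Config (TiltedSite d i j (2 * P + 1) (2 * P + 1) L) d G → ℂ) (hij : i ≠ j)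
    (U : Config (TiltedSite d i j (2 * P + 1) (2 * P + 1) L) d G) : ℂ :=
  gTwo ρ β F U * conj (gTwo ρ β F (configReflect (tiltedUnit d i j (2 * P + 1) (2 * P + 1) L) i
    (tiltedAxisFlip d L (2 * P + 1) hij) U))

/-- The observable of the mechanism at the feature parameter `u`: `Ψ_u = g · e_ψ(a(·), u)`,
`ψ = ω_β^{⋆M}`. -/
def psiTwo (β : ℝ) (F : Config (TiltedSite d i j (2 * P + 1) (2 * P + 1) L) d G → ℂ) (u : G)
    (U : Config (TiltedSite d i j (2 * P + 1) (2 * P + 1) L) d G) : ℂ :=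
  gTwo ρ β F U * (SlabKernel.featureMap (SlabKernel.convPow (SlabKernel.wilsonWt ρ β) (2 * P + 1))
    (SlabKernel.oprod aFn (2 * (2 * P + 1)) U) u : ℂ)

omit [MeasurableSpace G] [BorelSpace G] [SecondCountableTopology G] in
open scoped Classical in
/-- **The split of the Boltzmann weight**:
`e^{-βS(U)} conj F(ΘU) F(U) = e^{-βN·2M} · h(U) · ∏_{t<2M} plaqWt_t(U)`. [folklore] -/
theorem boltzmann_split (hij : i ≠ j) (hd : ∀ k : Fin d, k = i ∨ k = j) (hρ : Continuous ρ) (β : ℝ)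
    (F : Config (TiltedSite d i j (2 * P + 1) (2 * P + 1) L) d G → ℂ)
    (U : Config (TiltedSite d i j (2 * P + 1) (2 * P + 1) L) d G) :
    (Real.exp (-β * wilsonAction ρ (tiltedUnit d i j (2 * P + 1) (2 * P + 1) L) U) : ℂ) *
      (conj (F (configReflect (tiltedUnit d i j (2 * P + 1) (2 * P + 1) L) i (tiltedAxisFlip d L (2 * P + 1) hij) U)) *
        F U) =
      (Real.exp (-β * N * (2 * (2 * P + 1))) : ℂ) * (hTwo ρ β F hij U *
        ∏ t ∈ Finset.range (2 * (2 * P + 1)), SlabKernel.plaqWt (SlabKernel.wilsonWt ρ β) rung aFn bFn t U) := by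
  have hE := oddExpo_configReflect_add (L := L) ρ hij hρ U
  have hS : -β * wilsonAction ρ (tiltedUnit d i j (2 * P + 1) (2 * P + 1) L) U =
      -β * oddExpo ρ U + -β * oddExpo ρ (configReflect (tiltedUnit d i j (2 * P + 1) (2 * P + 1) L) i
        (tiltedAxisFlip d L (2 * P + 1) hij) U) +
        -β * ∑ p ∈ Finset.univ.filter (IsSlabPlaq (P := P)),
          ((N : ℝ) - plaqObs ρ (tiltedUnit d i j (2 * P + 1) (2 * P + 1) L) p U) := by
    linear_combination β * hE
  rw [hS, Real.exp_add, Real.exp_add, Complex.ofReal_mul, Complex.ofReal_mul, exp_slab_eq ρ hij hd hρ β U,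
    hTwo, gTwo, gTwo, map_mul, Complex.conj_ofReal]
  ring

variable [DecidableEq (TiltedSite d i j (2 * P + 1) (2 * P + 1) L)]

omit [NeZero P] [DecidableEq (TiltedSite d i j (2 * P + 1) (2 * P + 1) L)] in
/-- `g` is measurable and bounded. [folklore] -/
theorem measurable_gTwo_and_bound (hρ : Continuous ρ) (β : ℝ)
    {F : Config (TiltedSite d i j (2 * P + 1) (2 * P + 1) L) d G → ℂ} (hFm : Measurable F) {CF : ℝ}
    (hFb : ∀ U, ‖F U‖ ≤ CF) :
    Measurable (gTwo ρ β F) ∧ ∃ Cg : ℝ, ∀ U, ‖gTwo ρ β F U‖ ≤ Cg := by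
  obtain ⟨CE, hCE⟩ := (isCompact_univ (X := Config (TiltedSite d i j (2 * P + 1) (2 * P + 1) L) d G)).exists_bound_of_continuousOn
    (continuous_oddExpo (L := L) (P := P) ρ hρ).continuousOn
  refine ⟨hFm.mul (Complex.measurable_ofReal.comp
    ((Real.continuous_exp.comp (continuous_const.mul (continuous_oddExpo ρ hρ))).measurable)),
    CF * Real.exp (|β| * CE), fun U => ?_⟩
  rw [gTwo, norm_mul, Complex.norm_real, Real.norm_eq_abs, abs_of_pos (Real.exp_pos _)]
  refine mul_le_mul (hFb U) (Real.exp_le_exp.2 ?_) (Real.exp_pos _).le ((norm_nonneg _).trans (hFb U))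
  calc -β * oddExpo ρ U ≤ |-β * oddExpo ρ U| := le_abs_self _
    _ = |β| * |oddExpo ρ U| := by rw [abs_mul, abs_neg]
    _ ≤ |β| * CE := mul_le_mul_of_nonneg_left (by simpa using hCE U (Set.mem_univ _)) (abs_nonneg _)

/-- **Rung elimination and the invisible twist**:
`∫ h ∏_t plaqWt_t dU = ∫ h(U) · k_ψ(a(U), a(Θ_i U)) dU`. [folklore] -/
theorem integral_hTwo_annulus (hij : i ≠ j) (hd : ∀ k : Fin d, k = i ∨ k = j) (hρ : Continuous ρ) (β : ℝ)
    {F : Config (TiltedSite d i j (2 * P + 1) (2 * P + 1) L) d G → ℂ} (hFm : Measurable F) {CF : ℝ}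
    (hFb : ∀ U, ‖F U‖ ≤ CF)
    (hFo : IsHalfObservable (tiltedUnit d i j (2 * P + 1) (2 * P + 1) L) (2 * P + 1) (axisHeight2 d L (2 * P + 1)) F) :
    ∫ U, hTwo ρ β F hij U * ∏ t ∈ Finset.range (2 * (2 * P + 1)),
        SlabKernel.plaqWt (SlabKernel.wilsonWt ρ β) rung aFn bFn t U
      ∂(productHaar (TiltedSite d i j (2 * P + 1) (2 * P + 1) L) d G) =
    ∫ U, hTwo ρ β F hij U * (SlabKernel.slabKernel (SlabKernel.convPow (SlabKernel.wilsonWt ρ β) (2 * P + 1))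
        (SlabKernel.oprod aFn (2 * (2 * P + 1)) U)
        (SlabKernel.oprod aFn (2 * (2 * P + 1)) (configReflect (tiltedUnit d i j (2 * P + 1) (2 * P + 1) L) i
          (tiltedAxisFlip d L (2 * P + 1) hij) U)) : ℂ)
      ∂(productHaar (TiltedSite d i j (2 * P + 1) (2 * P + 1) L) d G) := by
  have hAF : IsAxisFlip (tiltedUnit d i j (2 * P + 1) (2 * P + 1) L) i (tiltedAxisFlip d L (2 * P + 1) hij) :=
    isAxisFlip_tiltedAxisFlip d L (2 * P + 1) hij
  haveI : IsProbabilityMeasure (haarProbability G) := CompactGroup.isProbabilityMeasure_haarMeasure_top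
  obtain ⟨hgm, Cg, hgb⟩ := measurable_gTwo_and_bound ρ hρ β hFm hFb
  have hΘm : Measurable (configReflect (G := G) (tiltedUnit d i j (2 * P + 1) (2 * P + 1) L) i
      (tiltedAxisFlip d L (2 * P + 1) hij)) := (hAF.measurePreserving_configReflect (G := G)).measurable
  have hhm : Measurable (hTwo ρ β F hij) := hgm.mul (Complex.continuous_conj.measurable.comp (hgm.comp hΘm))
  have hhb : ∀ U, ‖hTwo ρ β F hij U‖ ≤ Cg * Cg := fun U => by
    rw [hTwo, norm_mul, Complex.norm_conj]
    exact mul_le_mul (hgb U) (hgb _) (norm_nonneg _) ((norm_nonneg _).trans (hgb U))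
  have hhu : ∀ s U z, hTwo ρ β F hij (update U (rung s) z) = hTwo ρ β F hij U := fun s U z => by
    unfold hTwo
    rw [gTwo_eq_of_halfLinks ρ β hFo fun l hl => halfLinks_update_rung hij U s z l hl,
      gTwo_eq_of_halfLinks ρ β hFo fun l hl => configReflect_update_rung hij hd U s z l hl]
  unfold productHaar
  rw [SlabKernel.integral_mul_annulus (r := rung) (a := aFn) (b := bFn) (SlabKernel.continuous_wilsonWt ρ hρ β)
    (SlabKernel.wilsonWt_central ρ β) (show 1 ≤ 2 * P + 1 by omega)
    (by simpa using rung_add_two_mul (L := L) (P := P) hij 0) (rung_inj hij)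
    (fun t => continuous_apply _) (fun t => continuous_apply _) (aFn_update hij) (bFn_update hij) hhm hhb hhu]
  refine integral_congr_ae (ae_of_all _ fun U => ?_)
  dsimp only
  rw [oprod_bFn_eq_conj hij U, SlabKernel.slabKernel_conj_right]

/-! ## The main theorem -/

/-- **Pointwise in the feature parameter, the shared-block mechanism applies**:
`0 ≤ ∫ Ψ_u(U) conj Ψ_u(Θ_i U) dU`. [folklore] -/
theorem integral_psiTwo_nonneg (hij : i ≠ j) (hd : ∀ k : Fin d, k = i ∨ k = j) (hρ : Continuous ρ) (β : ℝ)
    {F : Config (TiltedSite d i j (2 * P + 1) (2 * P + 1) L) d G → ℂ} (hFm : Measurable F) {CF : ℝ}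
    (hFb : ∀ U, ‖F U‖ ≤ CF)
    (hFo : IsHalfObservable (tiltedUnit d i j (2 * P + 1) (2 * P + 1) L) (2 * P + 1) (axisHeight2 d L (2 * P + 1)) F)
    (u : G) :
    0 ≤ ∫ U, psiTwo ρ β F u U * conj (psiTwo ρ β F u (configReflect (tiltedUnit d i j (2 * P + 1) (2 * P + 1) L) i
      (tiltedAxisFlip d L (2 * P + 1) hij) U)) ∂(productHaar (TiltedSite d i j (2 * P + 1) (2 * P + 1) L) d G) := by
  have hAF : IsAxisFlip (tiltedUnit d i j (2 * P + 1) (2 * P + 1) L) i (tiltedAxisFlip d L (2 * P + 1) hij) :=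
    isAxisFlip_tiltedAxisFlip d L (2 * P + 1) hij
  haveI : IsProbabilityMeasure (haarProbability G) := CompactGroup.isProbabilityMeasure_haarMeasure_top
  obtain ⟨hgm, Cg, hgb⟩ := measurable_gTwo_and_bound ρ hρ β hFm hFb
  have hψc : Continuous (SlabKernel.convPow (SlabKernel.wilsonWt ρ β) (2 * P + 1)) :=
    SlabKernel.continuous_convPow (SlabKernel.continuous_wilsonWt ρ hρ β) _
  obtain ⟨Cψ, -, hCψ⟩ := Literature.MathematicalPhysics.QuantumLattice.exists_forall_abs_le_of_continuous hψc
  have hαc : Continuous fun U : Config (TiltedSite d i j (2 * P + 1) (2 * P + 1) L) d G =>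
      SlabKernel.oprod aFn (2 * (2 * P + 1)) U := SlabKernel.continuous_oprod (fun t => continuous_apply _) _
  have hΨm : Measurable (psiTwo ρ β F u) := hgm.mul (Complex.measurable_ofReal.comp
    ((SlabKernel.continuous_featureMap_left hψc u).comp hαc).measurable)
  have hΨb : ∀ U, ‖psiTwo ρ β F u U‖ ≤ Cg * Cψ := fun U => by
    rw [psiTwo, norm_mul, Complex.norm_real, Real.norm_eq_abs]
    exact mul_le_mul (hgb U) (SlabKernel.abs_featureMap_le hCψ _ _) (abs_nonneg _) ((norm_nonneg _).trans (hgb U))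
  have hΨdep : DependsOn (psiTwo ρ β F u) ((posBlock d i j L P ∪ ∅ ∪ shBlock d i j L P : Finset _) : Set _) := by
    intro U V hUV
    have hhalf : ∀ l, IsHalfLink (tiltedUnit d i j (2 * P + 1) (2 * P + 1) L) (2 * P + 1)
        (axisHeight2 d L (2 * P + 1)) l → U l = V l := fun l hl => by
      refine hUV l ?_
      rw [Finset.union_empty, Finset.coe_union, Set.mem_union, Finset.mem_coe, Finset.mem_coe]
      exact (isHalfLink_iff_mem_blocks hij hd l).1 hl
    have hα : SlabKernel.oprod aFn (2 * (2 * P + 1)) U = SlabKernel.oprod aFn (2 * (2 * P + 1)) V := by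
      unfold SlabKernel.oprod
      congr 1
      refine List.map_congr_left fun t _ => ?_
      exact hUV _ (by
        rw [Finset.union_empty, Finset.coe_union, Set.mem_union, Finset.mem_coe]
        exact Or.inl (aLink_mem_posBlock hij t))
    simp only [psiTwo, gTwo_eq_of_halfLinks ρ β hFo hhalf, hα]
  have key := integral_splice_mul_conj_comp_of_shared_nonneg (haarProbability G) (shBlock d i j L P)
    (posBlock d i j L P) ∅ _ (hAF.measurePreserving_configReflect (G := G))
    (fun U l hl => configReflect_apply_of_mem_shBlock hij U hl)
    (fun l hl => dependsOn_configReflect_apply hij hd l hl) (disjoint_shBlock_posBlock hij)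
    (Finset.disjoint_empty_right _) hΨm hΨb hΨdep
  simp only [splice_eq_piecewise, Finset.piecewise_empty] at key
  unfold productHaar
  rwa [integral_fun_fst (fun U => psiTwo ρ β F u U * conj (psiTwo ρ β F u (configReflect
      (tiltedUnit d i j (2 * P + 1) (2 * P + 1) L) i (tiltedAxisFlip d L (2 * P + 1) hij) U))),
    probReal_univ, one_smul] at key

omit [DecidableEq (TiltedSite d i j (2 * P + 1) (2 * P + 1) L)] in
/-- **Reflection positivity of the hybrid axis mirror in two dimensions.** On the square tilted box
`ℤ^d/Γ(2P+1, 2P+1, L)` with `d = 2` directions (`∀ k, k = i ∨ k = j`), `P ≥ 1`, for a compact second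
countable group `G`, a continuous matrix representation `ρ` and EVERY real `β`: for every bounded
measurable observable `F` of the closed half `{0 ≤ x_i ≤ P}`,
`0 ≤ ∫ conj F(Θ_i U) F(U) dμ_β(U)`, `Θ_i` the axis flip `x_i ↦ -x_i`. (In `d ≥ 3` this fails for
`β > 0`: `not_tiltedBox_axisRP_odd`.) Small new positive result; 2D YM gluing. -/
theorem tiltedBox_axisRP_odd_twoDim (hij : i ≠ j) (hd : ∀ k : Fin d, k = i ∨ k = j) (hρ : Continuous ρ)
    (β : ℝ) (F : Config (TiltedSite d i j (2 * P + 1) (2 * P + 1) L) d G → ℂ) (hFm : Measurable F)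
    (hFb : ∃ C : ℝ, ∀ U, ‖F U‖ ≤ C)
    (hFo : IsHalfObservable (tiltedUnit d i j (2 * P + 1) (2 * P + 1) L) (2 * P + 1) (axisHeight2 d L (2 * P + 1)) F) :
    0 ≤ ∫ U, conj (F (configReflect (tiltedUnit d i j (2 * P + 1) (2 * P + 1) L) i
        (tiltedAxisFlip d L (2 * P + 1) hij) U)) * F U
      ∂(gibbs ρ (tiltedUnit d i j (2 * P + 1) (2 * P + 1) L) β) := by
  classical
  obtain ⟨CF, hFb⟩ := hFb
  have hAF : IsAxisFlip (tiltedUnit d i j (2 * P + 1) (2 * P + 1) L) i (tiltedAxisFlip d L (2 * P + 1) hij) :=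
    isAxisFlip_tiltedAxisFlip d L (2 * P + 1) hij
  haveI : IsProbabilityMeasure (haarProbability G) := CompactGroup.isProbabilityMeasure_haarMeasure_top
  -- Step 0: from the Wilson measure to the Boltzmann weight
  have hZ := normaliser_pos (A := TiltedSite d i j (2 * P + 1) (2 * P + 1) L) (G := G) ρ hρ
    (tiltedUnit d i j (2 * P + 1) (2 * P + 1) L) β
  rw [integral_gibbs]
  simp_rw [Complex.real_smul, Complex.ofReal_div, div_eq_mul_inv, mul_comm (Complex.ofReal _) ((_ : ℂ)⁻¹),
    mul_assoc]
  rw [integral_const_mul]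
  refine mul_nonneg (by rw [← Complex.ofReal_inv]; exact Complex.zero_le_real.2 (inv_nonneg.2 hZ.le)) ?_
  -- Step 1: split the Boltzmann weight; Step 2: integrate the rungs; Step 3: the twist is invisible
  simp_rw [boltzmann_split ρ hij hd hρ β F]
  rw [integral_const_mul]
  refine mul_nonneg (Complex.zero_le_real.2 (Real.exp_pos _).le) ?_
  rw [integral_hTwo_annulus ρ hij hd hρ β hFm hFb hFo]
  -- Step 4: the Gram form and Fubini over the feature parameter
  obtain ⟨hgm, Cg, hgb⟩ := measurable_gTwo_and_bound ρ hρ β hFm hFb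
  have hΘm : Measurable (configReflect (G := G) (tiltedUnit d i j (2 * P + 1) (2 * P + 1) L) i
      (tiltedAxisFlip d L (2 * P + 1) hij)) := (hAF.measurePreserving_configReflect (G := G)).measurable
  have hhm : Measurable (hTwo ρ β F hij) := hgm.mul (Complex.continuous_conj.measurable.comp (hgm.comp hΘm))
  have hhb : ∀ U, ‖hTwo ρ β F hij U‖ ≤ Cg * Cg := fun U => by
    rw [hTwo, norm_mul, Complex.norm_conj]
    exact mul_le_mul (hgb U) (hgb _) (norm_nonneg _) ((norm_nonneg _).trans (hgb U))
  have hωc := SlabKernel.continuous_wilsonWt ρ hρ β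
  have hωz := SlabKernel.wilsonWt_central ρ β
  have hαc : Continuous fun U : Config (TiltedSite d i j (2 * P + 1) (2 * P + 1) L) d G =>
      SlabKernel.oprod aFn (2 * (2 * P + 1)) U := SlabKernel.continuous_oprod (fun t => continuous_apply _) _
  haveI : IsFiniteMeasure (productHaar (TiltedSite d i j (2 * P + 1) (2 * P + 1) L) d G) := by
    unfold productHaar; infer_instance
  rw [SlabKernel.integral_mul_slabKernel_eq (productHaar (TiltedSite d i j (2 * P + 1) (2 * P + 1) L) d G)
    (ψ := SlabKernel.convPow (SlabKernel.wilsonWt ρ β) (2 * P + 1))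
    (a := fun U => SlabKernel.oprod aFn (2 * (2 * P + 1)) U)
    (b := fun U => SlabKernel.oprod aFn (2 * (2 * P + 1)) (configReflect (tiltedUnit d i j (2 * P + 1) (2 * P + 1) L) i
      (tiltedAxisFlip d L (2 * P + 1) hij) U))
    (SlabKernel.continuous_convPow hωc _) (SlabKernel.convPow_central hωz _)
    (SlabKernel.convPow_inv hωz (SlabKernel.wilsonWt_inv ρ hρ β) _) hhm hhb hαc.measurable
    (hαc.measurable.comp hΘm)]
  refine integral_nonneg_of_complex fun u => ?_
  -- Step 5: pointwise in `u`
  have key := integral_psiTwo_nonneg ρ hij hd hρ β hFm hFb hFo u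
  convert key using 2
  funext U
  simp only [psiTwo, hTwo, map_mul, Complex.conj_ofReal]
  ring

end TwoDim

end TiltedRP

end Summit.QuantumFields.GaugeBoot

end
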